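import Mathlib
import Summits.QuantumFields.YangMills.Theorems.CoarseStiffnessTailCappedCoarseStiffnessLAveragedJointPeierls
import Literature.MathematicalPhysics.QuantumFieldTheory.Balaban1983to89.T4PairDerivBridge

/-!
# Route `CoarseStiffnessTail` — THE QUADRATIC (sum-currency) TRANSFER FROM AVERAGED TO FINE PLAQUETTES, UNCONDITIONALLY:
# `Σ_{p ∈ Plaq_k} |Ū^k(∂p) − 1|² ≤ D_k²·#pairs·(2k+1)^d·Σ_{q ∈ Plaq_0} |U(∂q) − 1|²` (lead's certificate, seat `ym-line-cst-p1` g14; helper on 25301)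

THE THEOREMS (every `Params` — any `d`, `L`, `m`, `K` — every `SU(N)`, every depth `k ≤ m + K`, Bałaban's (0.4) average
`Ū^k = Averaging.iter blockAvg (exp[mean log]) k U`; NO small-field hypothesis):
* ★ `dist1_iter_sq_le_sum`: `|Ū^k(∂p) − 1|² ≤ D_k²·Σ_{q : blockIter k q₋ within coordinatewise offset k of p₋} |U(∂q) − 1|²`,
  `D_k = max(C₁^k, 4G·C₁^{k−1}/δ_N)`, `C₁ = L² + 6((d+2)L)²`, `G = ((d+2)L)²/4`, `δ_N` the tree's `deltaSU`;
* ★ `sum_dist1_iter_sq_le`: summed over `Plaq_k` with the fibre multiplicity `#pairs·(2k+1)^d` of g13's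
  `CoarseStiffnessTailAveragedJointPeierls.card_multiplicity_le`.

PROOF.  g13's iterated [Balaban1985Averaging] Prop. 1 in contrapositive form (`CoarseStiffnessTailIteratedProp1.exists_fine_ge_of_le_dist1_iter`:
`C₁^k·a ≤ |Ū^k(∂p) − 1|` with the guard `G·C₁^{k−1}·a < δ_N` forces a fine `q` near `p` with `a ≤ |U(∂q) − 1|`) is applied ONCE, at the
threshold `a = x/C₁^k` if `x = |Ū^k(∂p) − 1| ≤ C₁^k a₁` (`a₁ = δ_N/(2G·C₁^{k−1})`, so the guard holds), else at `a = a₁`: in the first case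
`x ≤ C₁^k·s`, in the second `a₁ ≤ s` and `x ≤ 2 ≤ (2/a₁)·s`, where `s² = Σ_{q near p}|U(∂q) − 1|²` dominates every single fine plaquette of
the region.  No limiting argument and no smallness: the guard is paid for by the constant `2/a₁`.  The sum over `p` is a double-counting
identity (`sum_comm`) plus the multiplicity bound.

WHY (line card `Cruxes/CappedCoarseStiffnessL/Lines/birth.md` §g13–§g14).  g13 used the MAX-currency transfer (one large averaged plaquette ⇒
one large fine plaquette) for the EDGE stub at bounded depth.  The BULK stub and the crux's capped tilt are QUADRATIC functionals; this file
is the deterministic inequality that lets the companion `…LBoundedDepthCompactCoupling` dominate the level-`j` stiffness by the bare one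
(`β_{K−j}·D_j²·3(2j+1)³ = (D_j²·3(2j+1)³/L^j)·β_K`) and so prove the CRUX ITSELF at every bounded depth on compact coupling ranges.  The constant
`D_k ∼ C₁^k` grows geometrically (Cauchy–Schwarz in max currency); the linearised truth is `O(L^{k/2})` (g11's Schur bound) — the gap is,
again, the multi-scale content of [Balaban1985UV3] and is not claimed.

HONEST SCOPE.  Lattice bookkeeping on the tree's own objects; nothing of Bałaban's estimates is proved; the crux 25301 (uniformity in the
depth and in `γ → 0`) and `HistoryTailL` 19936 stay OPEN; `YM3TorusSU2` (R3, RECORD rung, not Clay) is NOT proved; the Yang–Mills mass gap is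
NOT touched.

References: T. Bałaban, CMP **98** (1985) 17–51 [Balaban1985Averaging] (Prop. 1 (51) p.26); CMP **109** (1987) 249–301 [Balaban1987RG1]
((0.1) p.251, (0.4) p.253); CMP **102** (1985) 255–275 [Balaban1985UV3] ((38)–(40) p.266, (71) p.273).
-/

noncomputable section

namespace Summit.QuantumFields.YangMills.Theorems.CoarseStiffnessTailQuadraticTransfer

open Finset
open Literature.MathematicalPhysics.QuantumFieldTheory
open Literature.MathematicalPhysics.QuantumFieldTheory.Balaban1983to89
open Literature.MathematicalPhysics.QuantumFieldTheory.Balaban1983to89.B14.Eq22Determines (blockIter)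
open Literature.MathematicalPhysics.QuantumFieldTheory.Balaban1983to89.BlockAveraging (blockAvg)
open Literature.MathematicalPhysics.QuantumFieldTheory.Balaban1983to89.ExpMeanLog (expMeanLogSU deltaSU deltaSU_pos)
open Literature.MathematicalPhysics.QuantumFieldTheory.Balaban1983to89.T4PairDerivBridge (dist1_le_two_specialUnitaryGroup)
open Summit.QuantumFields.YangMills.Theorems.CoarseStiffnessTailIteratedProp1 (one_le_C₁ exists_fine_ge_of_le_dist1_iter)
open Summit.QuantumFields.YangMills.Theorems.CoarseStiffnessTailAveragedJointPeierls (card_multiplicity_le)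

/-! ## §1 THE QUADRATIC (sum-currency) TRANSFER: `|Ū^k(∂p) − 1|² ≤ D_k²·Σ_{q near p} |U(∂q) − 1|²`, unconditionally -/

section Transfer

variable {P : Params} {n : Type*} [Fintype n] [DecidableEq n] [Nonempty n]

open scoped Classical in
/-- **★ THE QUADRATIC TRANSFER, ONE AVERAGED PLAQUETTE** (every `Params`, every `SU(N)`, every `k ≤ m + K`, NO smallness hypothesis):
`|Ū^k(∂p) − 1|² ≤ D_k²·Σ_{q : blockIter k q₋ within offset k of p₋} |U(∂q) − 1|²`, `D_k = max(C₁^k, 4G·C₁^{k−1}/δ_N)`, `C₁ = L² + 6((d+2)L)²`,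
`G = ((d+2)L)²/4`.  From the tree's iterated [Balaban1985Averaging] Prop. 1 in contrapositive form
(`CoarseStiffnessTailIteratedProp1.exists_fine_ge_of_le_dist1_iter`): with `x = |Ū^k(∂p) − 1|`, `s² = Σ_{q near p}|U(∂q) − 1|²`, either
`x ≤ C₁^k a₁` (`a₁ = δ_N/(2G C₁^{k−1})`, the largest admissible threshold) and the contrapositive at `a = x/C₁^k` produces a fine `q` near `p` with
`x/C₁^k ≤ |U(∂q) − 1| ≤ s`, or `x > C₁^k a₁` and the contrapositive at `a₁` produces one with `a₁ ≤ |U(∂q) − 1| ≤ s`, whence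
`x ≤ 2 ≤ (2/a₁)s`. [cite: Balaban1985Averaging, Prop. 1 (51) p.26] -/
theorem dist1_iter_sq_le_sum {k : ℕ} (hk : k ≤ P.m + P.K) (U : GaugeField P 0 (Matrix.specialUnitaryGroup n ℂ)) (p : Plaq P k) :
    GaugeGroup.dist1 (GaugeField.plaqHol (Averaging.iter (fun i => blockAvg (P := P) (j := i) (expMeanLogSU (n := n))) k U) p) ^ 2 ≤
      (max (((P.L : ℝ) ^ 2 + 6 * (((P.d + 2) * P.L : ℕ) : ℝ) ^ 2) ^ k)
          (4 * ((((P.d + 2) * P.L : ℕ) : ℝ) ^ 2 / 4) * ((P.L : ℝ) ^ 2 + 6 * (((P.d + 2) * P.L : ℕ) : ℝ) ^ 2) ^ (k - 1) /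
            deltaSU n)) ^ 2 *
        ∑ q ∈ univ.filter (fun q : Plaq P 0 => ∀ κ, ∃ t : ℤ, |t| ≤ (k : ℤ) ∧
            blockIter k q.src κ = p.src κ + (t : ZMod (P.sitesPerDir k))), GaugeGroup.dist1 (GaugeField.plaqHol U q) ^ 2 := by
  set C₁ : ℝ := (P.L : ℝ) ^ 2 + 6 * (((P.d + 2) * P.L : ℕ) : ℝ) ^ 2 with hC₁
  set G : ℝ := (((P.d + 2) * P.L : ℕ) : ℝ) ^ 2 / 4 with hG
  set δ : ℝ := deltaSU n with hδ
  set x : ℝ := GaugeGroup.dist1 (GaugeField.plaqHol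
    (Averaging.iter (fun i => blockAvg (P := P) (j := i) (expMeanLogSU (n := n))) k U) p) with hx
  set R : Finset (Plaq P 0) := univ.filter (fun q : Plaq P 0 => ∀ κ, ∃ t : ℤ, |t| ≤ (k : ℤ) ∧
    blockIter k q.src κ = p.src κ + (t : ZMod (P.sitesPerDir k))) with hR
  set S : ℝ := ∑ q ∈ R, GaugeGroup.dist1 (GaugeField.plaqHol U q) ^ 2 with hS
  have hC₁1 : 1 ≤ C₁ := one_le_C₁
  have hG0 : 0 < G := by
    have h5 : (1 : ℝ) ≤ (((P.d + 2) * P.L : ℕ) : ℝ) := by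
      have := P.L_pos
      exact_mod_cast Nat.one_le_iff_ne_zero.2 (Nat.mul_ne_zero (by omega) (by omega))
    rw [hG]; positivity
  have hδ0 : 0 < δ := deltaSU_pos
  have hx0 : 0 ≤ x := GaugeGroup.dist1_nonneg _
  have hx2 : x ≤ 2 := dist1_le_two_specialUnitaryGroup _
  have hS0 : 0 ≤ S := sum_nonneg fun q _ => sq_nonneg _
  set s : ℝ := Real.sqrt S with hs
  have hs0 : 0 ≤ s := Real.sqrt_nonneg _
  -- every fine plaquette of the region is within `s` of `1`
  have hmem : ∀ q ∈ R, GaugeGroup.dist1 (GaugeField.plaqHol U q) ≤ s := fun q hq => by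
    have h1 : GaugeGroup.dist1 (GaugeField.plaqHol U q) ^ 2 ≤ S :=
      single_le_sum (f := fun q => GaugeGroup.dist1 (GaugeField.plaqHol U q) ^ 2) (fun q _ => sq_nonneg _) hq
    calc GaugeGroup.dist1 (GaugeField.plaqHol U q) = Real.sqrt (GaugeGroup.dist1 (GaugeField.plaqHol U q) ^ 2) :=
          (Real.sqrt_sq (GaugeGroup.dist1_nonneg _)).symm
      _ ≤ s := Real.sqrt_le_sqrt h1
  have hRmem : ∀ q : Plaq P 0, (∀ κ, ∃ t : ℤ, |t| ≤ (k : ℤ) ∧ blockIter k q.src κ = p.src κ + (t : ZMod (P.sitesPerDir k))) →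
      q ∈ R := fun q hq => by rw [hR, mem_filter]; exact ⟨mem_univ _, hq⟩
  -- the largest admissible threshold
  set a₁ : ℝ := δ / (2 * G * C₁ ^ (k - 1)) with ha₁
  have hCk1 : 0 < C₁ ^ (k - 1) := pow_pos (by linarith) _
  have hCk : 1 ≤ C₁ ^ k := one_le_pow₀ hC₁1
  have ha₁0 : 0 < a₁ := by rw [ha₁]; positivity
  have hguard₁ : G * (C₁ ^ (k - 1) * a₁) < δ := by
    have : G * (C₁ ^ (k - 1) * a₁) = δ / 2 := by rw [ha₁]; field_simp
    rw [this]; linarith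
  have hDa : 2 / a₁ = 4 * G * C₁ ^ (k - 1) / δ := by rw [ha₁]; field_simp; ring
  set D : ℝ := max (C₁ ^ k) (4 * G * C₁ ^ (k - 1) / δ) with hD
  have hD0 : 0 ≤ D := le_trans (by linarith) (le_max_left _ _)
  -- `x ≤ D·s`
  have hxs : x ≤ D * s := by
    by_cases hcase : x ≤ C₁ ^ k * a₁
    · set a : ℝ := x / C₁ ^ k with ha
      have ha0 : 0 ≤ a := by rw [ha]; positivity
      have hale : a ≤ a₁ := by
        rw [ha, div_le_iff₀ (by linarith)]; linarith
      have hguard : G * (C₁ ^ (k - 1) * a) < δ :=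
        lt_of_le_of_lt (mul_le_mul_of_nonneg_left (mul_le_mul_of_nonneg_left hale hCk1.le) hG0.le) hguard₁
      have hle : C₁ ^ k * a ≤ x := by rw [ha, mul_div_cancel₀ _ (by positivity)]
      obtain ⟨q, hq, hqa⟩ := exists_fine_ge_of_le_dist1_iter (n := n) k hk ha0 (by simpa [hC₁, hG] using hguard) U p
        (by simpa [hC₁, hx] using hle)
      have hqs := hmem q (hRmem q hq)
      calc x = C₁ ^ k * a := by rw [ha, mul_div_cancel₀ _ (by positivity)]
        _ ≤ C₁ ^ k * s := mul_le_mul_of_nonneg_left (hqa.trans hqs) (by linarith)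
        _ ≤ D * s := mul_le_mul_of_nonneg_right (le_max_left _ _) hs0
    · have hlt : C₁ ^ k * a₁ ≤ x := (not_le.1 hcase).le
      obtain ⟨q, hq, hqa⟩ := exists_fine_ge_of_le_dist1_iter (n := n) k hk ha₁0.le (by simpa [hC₁, hG] using hguard₁) U p
        (by simpa [hC₁, hx] using hlt)
      have hqs := hmem q (hRmem q hq)
      have has : a₁ ≤ s := hqa.trans hqs
      calc x ≤ 2 := hx2
        _ = 2 / a₁ * a₁ := by field_simp
        _ ≤ 2 / a₁ * s := mul_le_mul_of_nonneg_left has (by positivity)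
        _ ≤ D * s := mul_le_mul_of_nonneg_right (by rw [hDa]; exact le_max_right _ _) hs0
  calc x ^ 2 ≤ (D * s) ^ 2 := pow_le_pow_left₀ hx0 hxs 2
    _ = D ^ 2 * S := by rw [mul_pow, hs, Real.sq_sqrt hS0]

open scoped Classical in
/-- **★ THE QUADRATIC TRANSFER, SUMMED** (fibre multiplicity `#pairs·(2k+1)^d`, `CoarseStiffnessTailAveragedJointPeierls.card_multiplicity_le`):
`Σ_p |Ū^k(∂p) − 1|² ≤ D_k²·#pairs·(2k+1)^d·Σ_q |U(∂q) − 1|²` — the coarse square sum is dominated by the FINE square sum with a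
depth-dependent constant. [cite: Balaban1985Averaging, Prop. 1 (51) p.26] -/
theorem sum_dist1_iter_sq_le {k : ℕ} (hk : k ≤ P.m + P.K) (U : GaugeField P 0 (Matrix.specialUnitaryGroup n ℂ)) :
    ∑ p : Plaq P k, GaugeGroup.dist1 (GaugeField.plaqHol
        (Averaging.iter (fun i => blockAvg (P := P) (j := i) (expMeanLogSU (n := n))) k U) p) ^ 2 ≤
      (max (((P.L : ℝ) ^ 2 + 6 * (((P.d + 2) * P.L : ℕ) : ℝ) ^ 2) ^ k)
          (4 * ((((P.d + 2) * P.L : ℕ) : ℝ) ^ 2 / 4) * ((P.L : ℝ) ^ 2 + 6 * (((P.d + 2) * P.L : ℕ) : ℝ) ^ 2) ^ (k - 1) /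
            deltaSU n)) ^ 2 *
        ((Fintype.card {μν : Fin P.d × Fin P.d // μν.1 < μν.2} * (2 * k + 1) ^ P.d : ℕ) : ℝ) *
        ∑ q : Plaq P 0, GaugeGroup.dist1 (GaugeField.plaqHol U q) ^ 2 := by
  set D : ℝ := max (((P.L : ℝ) ^ 2 + 6 * (((P.d + 2) * P.L : ℕ) : ℝ) ^ 2) ^ k)
    (4 * ((((P.d + 2) * P.L : ℕ) : ℝ) ^ 2 / 4) * ((P.L : ℝ) ^ 2 + 6 * (((P.d + 2) * P.L : ℕ) : ℝ) ^ 2) ^ (k - 1) / deltaSU n) with hD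
  set M : ℕ := Fintype.card {μν : Fin P.d × Fin P.d // μν.1 < μν.2} * (2 * k + 1) ^ P.d with hM
  set f : Plaq P 0 → ℝ := fun q => GaugeGroup.dist1 (GaugeField.plaqHol U q) ^ 2 with hf
  have hf0 : ∀ q, 0 ≤ f q := fun q => sq_nonneg _
  -- per-plaquette transfer
  have h1 : ∑ p : Plaq P k, GaugeGroup.dist1 (GaugeField.plaqHol
      (Averaging.iter (fun i => blockAvg (P := P) (j := i) (expMeanLogSU (n := n))) k U) p) ^ 2 ≤
      ∑ p : Plaq P k, D ^ 2 * ∑ q ∈ univ.filter (fun q : Plaq P 0 => ∀ κ, ∃ t : ℤ, |t| ≤ (k : ℤ) ∧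
        blockIter k q.src κ = p.src κ + (t : ZMod (P.sitesPerDir k))), f q :=
    sum_le_sum fun p _ => dist1_iter_sq_le_sum hk U p
  -- swap the double sum and count the multiplicity
  have h2 : ∑ p : Plaq P k, ∑ q ∈ univ.filter (fun q : Plaq P 0 => ∀ κ, ∃ t : ℤ, |t| ≤ (k : ℤ) ∧
        blockIter k q.src κ = p.src κ + (t : ZMod (P.sitesPerDir k))), f q =
      ∑ q : Plaq P 0, ((univ.filter (fun p : Plaq P k => ∀ κ, ∃ t : ℤ, |t| ≤ (k : ℤ) ∧
        blockIter k q.src κ = p.src κ + (t : ZMod (P.sitesPerDir k)))).card : ℝ) * f q := by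
    simp_rw [sum_filter]
    rw [sum_comm]
    refine sum_congr rfl fun q _ => ?_
    rw [← sum_filter, sum_const, nsmul_eq_mul]
  have h3 : ∑ q : Plaq P 0, ((univ.filter (fun p : Plaq P k => ∀ κ, ∃ t : ℤ, |t| ≤ (k : ℤ) ∧
        blockIter k q.src κ = p.src κ + (t : ZMod (P.sitesPerDir k)))).card : ℝ) * f q ≤
      ∑ q : Plaq P 0, (M : ℝ) * f q :=
    sum_le_sum fun q _ => mul_le_mul_of_nonneg_right (by exact_mod_cast card_multiplicity_le q) (hf0 q)
  calc ∑ p : Plaq P k, GaugeGroup.dist1 (GaugeField.plaqHol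
        (Averaging.iter (fun i => blockAvg (P := P) (j := i) (expMeanLogSU (n := n))) k U) p) ^ 2
      ≤ D ^ 2 * ∑ p : Plaq P k, ∑ q ∈ univ.filter (fun q : Plaq P 0 => ∀ κ, ∃ t : ℤ, |t| ≤ (k : ℤ) ∧
          blockIter k q.src κ = p.src κ + (t : ZMod (P.sitesPerDir k))), f q := by rw [mul_sum]; exact h1
    _ ≤ D ^ 2 * ∑ q : Plaq P 0, (M : ℝ) * f q := by rw [h2]; exact mul_le_mul_of_nonneg_left h3 (sq_nonneg _)
    _ = D ^ 2 * (M : ℝ) * ∑ q : Plaq P 0, f q := by rw [← mul_sum, mul_assoc]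

end Transfer

end Summit.QuantumFields.YangMills.Theorems.CoarseStiffnessTailQuadraticTransfer

end
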